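/-
Copyright (c) 2026. All rights reserved.
Released under Apache 2.0 license as described in the file LICENSE.
Authors: abc-iut cell, seat abc-iut-L4-t15 (gen 6).
-/
import Mathlib.GroupTheory.Commutator.Basic
import Mathlib.Algebra.BigOperators.Fin
import Mathlib.Tactic.Group
import Mathlib.Algebra.Group.Submonoid.BigOperators

/-!
# Ordered products of commutators: the Nikolov–Segal "derivative" and Hensel-type descent

For a group `G`, a tuple of "slots" `g : Fin d → G` and a tuple of "entries" `v : Fin d → G` we consider
the ORDERED product of commutators

  `Φ_g(v) = ⁅v 0, g 0⁆ * ⁅v 1, g 1⁆ * ⋯ * ⁅v (d-1), g (d-1)⁆`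

(written inline as `(List.ofFn fun j => ⁅v j, g j⁆).prod`; Mathlib's convention
`⁅a, b⁆ = a * b * a⁻¹ * b⁻¹`).  This file proves the two purely algebraic facts that drive the
Nikolov–Segal method of "solving equations in a finite group by successive approximation"
(N. Nikolov, D. Segal, *On finitely generated profinite groups I*, Ann. of Math. 165 (2007), §4):

* `exists_conj_forall_prod_commutator_mul` — the **derivative formula** (loc. cit. Lemma 4.3, in Mathlib's
  commutator convention): for fixed `g, v` there are `τ j ∈ G` (namely `τ j = c₀ ⋯ c_{j-1} v_j` with
  `c_i = ⁅v i, g i⁆`) such that for EVERY `x`,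
  `Φ_g(v·x) = (∏_j τ j * ⁅x j, g j⁆ * (τ j)⁻¹) * Φ_g(v)`; since `τ ⁅x, g⁆ τ⁻¹ = ⁅τxτ⁻¹, τgτ⁻¹⁆` the
  correction factor is again an ordered product of commutators, in the CONJUGATED slots `τ j * g j * (τ j)⁻¹`;
* `exists_prod_commutator_mem_of_layers` — **Hensel-type descent**: if along a chain of normal subgroups
  `A 0 ⊇ A 1 ⊇ ⋯ ⊇ A r` every layer is "solvable for every conjugate of the slot tuple" (for all `c` and
  all `κ ∈ A i` there are entries `y j` in a fixed normal subgroup `H` with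
  `κ⁻¹ * Φ_{c•g}(y) ∈ A (i+1)`, where `(c•g) j = c j * g j * (c j)⁻¹`), then every `κ ∈ A 0` satisfies
  `κ⁻¹ * Φ_{c•g}(x) ∈ A r` for suitable entries `x j ∈ H` — WITHOUT increasing the number of slots.

Everything here is valid in an arbitrary group (no finiteness, no topology).  These are the bookkeeping
lemmas behind the bounded-commutator-width theorem for `p`-group-by-metacyclic finite groups
(`Literature/GroupTheory/BoundedCommutatorWidthPByMetacyclic.lean`, cell abc-iut, GAP-LEDGER G-L3d2g2-1);
nothing of the classification of finite simple groups is involved.  No definitions, no instances.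
-/

namespace Literature.GroupTheory

open scoped commutatorElement

variable {G : Type*} [Group G]

/-! ### Conjugating an ordered product -/

/-- Conjugation distributes over an ordered product:
`a * (∏_j f j) * a⁻¹ = ∏_j (a * f j * a⁻¹)`.  Elementary (apply the automorphism `MulAut.conj a`).
[folklore] -/
private theorem conj_prod_ofFn {d : ℕ} (a : G) (f : Fin d → G) :
    a * (List.ofFn f).prod * a⁻¹ = (List.ofFn fun j => a * f j * a⁻¹).prod := by
  have h := map_list_prod (MulAut.conj a).toMonoidHom (List.ofFn f)
  simp only [MulEquiv.coe_toMonoidHom, MulAut.conj_apply, List.map_ofFn] at h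
  simpa [Function.comp_def] using h

/-! ### The derivative formula -/

/-- **Derivative formula for ordered products of commutators** (Nikolov–Segal, Ann. of Math. 165 (2007),
Lemma 4.3, transcribed to the convention `⁅a,b⁆ = aba⁻¹b⁻¹` with entries multiplied on the RIGHT).
For slots `g` and entries `v` there exist `τ j` (depending on `g, v` only) such that for every tuple `x`,
`∏_j ⁅v j * x j, g j⁆ = (∏_j τ j * ⁅x j, g j⁆ * (τ j)⁻¹) * ∏_j ⁅v j, g j⁆`.
(Explicitly `τ j = ⁅v 0,g 0⁆ ⋯ ⁅v (j-1), g (j-1)⁆ * v j`.) [cite: NikolovSegal2007, Lemma 4.3] -/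
theorem exists_conj_forall_prod_commutator_mul (d : ℕ) (g v : Fin d → G) :
    ∃ τ : Fin d → G, ∀ x : Fin d → G,
      (List.ofFn fun j => ⁅v j * x j, g j⁆).prod =
        (List.ofFn fun j => τ j * ⁅x j, g j⁆ * (τ j)⁻¹).prod * (List.ofFn fun j => ⁅v j, g j⁆).prod := by
  induction d with
  | zero =>
    refine ⟨Fin.elim0, fun x => ?_⟩
    simp
  | succ d ih =>
    obtain ⟨τ', hτ'⟩ := ih (fun i => g i.succ) (fun i => v i.succ)
    -- `c₀ = ⁅v 0, g 0⁆`; `τ 0 = v 0`, `τ (i+1) = c₀ * τ' i`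
    refine ⟨Fin.cons (v 0) (fun i => ⁅v 0, g 0⁆ * τ' i), fun x => ?_⟩
    have htail := hτ' (fun i => x i.succ)
    simp only [List.ofFn_succ, List.prod_cons, Fin.cons_zero, Fin.cons_succ]
    rw [htail, commutatorElement_mul_left_eq_conj_mul (v 0) (x 0) (g 0)]
    -- abbreviations
    set c₀ : G := ⁅v 0, g 0⁆ with hc₀
    set A : G := v 0 * ⁅x 0, g 0⁆ * (v 0)⁻¹ with hA
    set T' : G := (List.ofFn fun i : Fin d => τ' i * ⁅x i.succ, g i.succ⁆ * (τ' i)⁻¹).prod with hT'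
    set V' : G := (List.ofFn fun i : Fin d => ⁅v i.succ, g i.succ⁆).prod with hV'
    have hconj : c₀ * T' * c₀⁻¹ =
        (List.ofFn fun i : Fin d => c₀ * τ' i * ⁅x i.succ, g i.succ⁆ * (c₀ * τ' i)⁻¹).prod := by
      rw [hT', conj_prod_ofFn]
      exact congrArg (fun f : Fin d → G => (List.ofFn f).prod)
        (funext fun i => by simp only [mul_inv_rev, mul_assoc])
    calc A * c₀ * (T' * V') = A * (c₀ * T' * c₀⁻¹) * (c₀ * V') := by group
      _ = A * (List.ofFn fun i : Fin d => c₀ * τ' i * ⁅x i.succ, g i.succ⁆ * (c₀ * τ' i)⁻¹).prod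
            * (c₀ * V') := by rw [hconj]

/-- **Derivative formula, conjugated-slot form.** With `τ` as in
`exists_conj_forall_prod_commutator_mul`, the correction factor is itself an ordered product of
commutators in the conjugated slots: `∏_j ⁅v j * x j, g j⁆ = (∏_j ⁅τ j * x j * (τ j)⁻¹, τ j * g j * (τ j)⁻¹⁆)
* ∏_j ⁅v j, g j⁆`. [cite: NikolovSegal2007, Lemma 4.3] -/
theorem exists_conj_forall_prod_commutator_mul' (d : ℕ) (g v : Fin d → G) :
    ∃ τ : Fin d → G, ∀ x : Fin d → G,
      (List.ofFn fun j => ⁅v j * x j, g j⁆).prod =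
        (List.ofFn fun j => ⁅τ j * x j * (τ j)⁻¹, τ j * g j * (τ j)⁻¹⁆).prod *
          (List.ofFn fun j => ⁅v j, g j⁆).prod := by
  obtain ⟨τ, hτ⟩ := exists_conj_forall_prod_commutator_mul d g v
  refine ⟨τ, fun x => ?_⟩
  rw [hτ x]
  exact congrArg (fun f : Fin d → G => (List.ofFn f).prod * (List.ofFn fun j => ⁅v j, g j⁆).prod)
    (funext fun j => conjugate_commutatorElement _ _ _)

/-! ### Hensel-type descent along a chain of normal subgroups -/

/-- **One lifting step.** Let `H, A, B` be normal subgroups, `g` a slot tuple and `c` a tuple of conjugating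
elements. Suppose the layer `A ⊇ B`-step is solvable for EVERY conjugate of the slots with entries in `H`:
for all `c'` and all `κ ∈ A` there is `y` with `y j ∈ H` and `κ⁻¹ * ∏_j ⁅y j, c' j * g j * (c' j)⁻¹⁆ ∈ B`.
If `x` (entries in `H`) solves `κ⁻¹ * Φ(x) ∈ A`, then some `x'` (entries in `H`) solves
`κ⁻¹ * Φ(x') ∈ B`, where `Φ(x) = ∏_j ⁅x j, c j * g j * (c j)⁻¹⁆`.  The proof multiplies the entries of
`x` on the right by a correction `y` and uses the derivative formula. [cite: NikolovSegal2007, §4] -/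
theorem exists_prod_commutator_mem_step {d : ℕ} (H A B : Subgroup G) [hH : H.Normal] [hA : A.Normal]
    [hB : B.Normal] (g c : Fin d → G)
    (hstep : ∀ c' : Fin d → G, ∀ κ ∈ A, ∃ y : Fin d → G, (∀ j, y j ∈ H) ∧
      κ⁻¹ * (List.ofFn fun j => ⁅y j, c' j * g j * (c' j)⁻¹⁆).prod ∈ B)
    (κ : G) (x : Fin d → G) (hx : ∀ j, x j ∈ H)
    (hκ : κ⁻¹ * (List.ofFn fun j => ⁅x j, c j * g j * (c j)⁻¹⁆).prod ∈ A) :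
    ∃ x' : Fin d → G, (∀ j, x' j ∈ H) ∧
      κ⁻¹ * (List.ofFn fun j => ⁅x' j, c j * g j * (c j)⁻¹⁆).prod ∈ B := by
  -- derivative of `Φ` at `x`
  obtain ⟨τ, hτ⟩ := exists_conj_forall_prod_commutator_mul' d (fun j => c j * g j * (c j)⁻¹) x
  set Φx : G := (List.ofFn fun j => ⁅x j, c j * g j * (c j)⁻¹⁆).prod with hΦx
  -- `a := κ⁻¹ Φx ∈ A`; the element to be hit by the correction is `κ₁ := κ a⁻¹ κ⁻¹ ∈ A`
  set a : G := κ⁻¹ * Φx with ha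
  have haA : a ∈ A := hκ
  set κ₁ : G := κ * a⁻¹ * κ⁻¹ with hκ₁
  have hκ₁A : κ₁ ∈ A := hA.conj_mem _ (A.inv_mem haA) κ
  -- solve the layer at the conjugate tuple `τ j * c j`
  obtain ⟨y'', hy''H, hy''⟩ := hstep (fun j => τ j * c j) κ₁ hκ₁A
  -- pull the entries back: `y j := (τ j)⁻¹ * y'' j * τ j`
  refine ⟨fun j => x j * ((τ j)⁻¹ * y'' j * τ j), fun j => H.mul_mem (hx j) ?_, ?_⟩
  · have := hH.conj_mem _ (hy''H j) (τ j)⁻¹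
    simpa [mul_assoc] using this
  · -- `Φ(x·y) = Ψ(y) * Φ(x)` with `Ψ(y) = ∏ ⁅τ y τ⁻¹, τ (c g c⁻¹) τ⁻¹⁆ = ∏ ⁅y'', (τc) g (τc)⁻¹⁆`
    have hrew := hτ (fun j => (τ j)⁻¹ * y'' j * τ j)
    have hΨ : (List.ofFn fun j => ⁅τ j * ((τ j)⁻¹ * y'' j * τ j) * (τ j)⁻¹,
        τ j * (c j * g j * (c j)⁻¹) * (τ j)⁻¹⁆).prod =
        (List.ofFn fun j => ⁅y'' j, τ j * c j * g j * (τ j * c j)⁻¹⁆).prod := by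
      refine congrArg (fun f : Fin d → G => (List.ofFn f).prod) (funext fun j => ?_)
      congr 1
      · group
      · simp only [mul_inv_rev, mul_assoc]
    rw [hrew, hΨ]
    set Ψ : G := (List.ofFn fun j => ⁅y'' j, τ j * c j * g j * (τ j * c j)⁻¹⁆).prod with hΨdef
    -- target: `κ⁻¹ * (Ψ * Φx) ∈ B`; we know `κ₁⁻¹ * Ψ ∈ B`
    have hy : κ₁⁻¹ * Ψ ∈ B := by
      have := hy''
      simpa [hΨdef, mul_assoc] using this
    have hΦx' : Φx = κ * a := by rw [ha]; group
    have key : κ⁻¹ * (Ψ * Φx) = (κ * a)⁻¹ * (κ₁⁻¹ * Ψ) * (κ * a) := by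
      rw [hΦx', hκ₁]; group
    rw [key]
    exact hB.conj_mem' _ hy (κ * a)

/-- **Hensel-type descent along a chain of normal subgroups** (the successive-approximation scheme of
Nikolov–Segal, Ann. of Math. 165 (2007) §4, in exact — non-probabilistic — form).  Let `H` be a normal
subgroup, `A : ℕ → Subgroup G` a chain of normal subgroups and `r : ℕ`.  Suppose each layer
`A i ⊇ A (i+1)` (`i < r`) is solvable for every conjugate `c' • g` of the slot tuple with entries in `H`.
Then for every conjugating tuple `c` and every `κ ∈ A 0` there are entries `x j ∈ H` with
`κ⁻¹ * ∏_j ⁅x j, c j * g j * (c j)⁻¹⁆ ∈ A r` — the number of commutator factors never grows.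
[cite: NikolovSegal2007, §4] -/
theorem exists_prod_commutator_mem_of_layers {d : ℕ} (H : Subgroup G) [H.Normal] (g : Fin d → G)
    (A : ℕ → Subgroup G) (hAn : ∀ i, (A i).Normal) (r : ℕ)
    (hstep : ∀ i < r, ∀ c' : Fin d → G, ∀ κ ∈ A i, ∃ y : Fin d → G, (∀ j, y j ∈ H) ∧
      κ⁻¹ * (List.ofFn fun j => ⁅y j, c' j * g j * (c' j)⁻¹⁆).prod ∈ A (i + 1))
    (c : Fin d → G) (κ : G) (hκ : κ ∈ A 0) :
    ∃ x : Fin d → G, (∀ j, x j ∈ H) ∧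
      κ⁻¹ * (List.ofFn fun j => ⁅x j, c j * g j * (c j)⁻¹⁆).prod ∈ A r := by
  -- induction on the level reached
  have main : ∀ i ≤ r, ∃ x : Fin d → G, (∀ j, x j ∈ H) ∧
      κ⁻¹ * (List.ofFn fun j => ⁅x j, c j * g j * (c j)⁻¹⁆).prod ∈ A i := by
    intro i
    induction i with
    | zero =>
      intro _
      refine ⟨fun _ => 1, fun _ => H.one_mem, ?_⟩
      simpa using (A 0).inv_mem hκ
    | succ i ih =>
      intro hi
      obtain ⟨x, hxH, hx⟩ := ih (Nat.le_of_succ_le hi)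
      haveI := hAn i
      haveI := hAn (i + 1)
      exact exists_prod_commutator_mem_step H (A i) (A (i + 1)) g c
        (hstep i (Nat.lt_of_succ_le hi)) κ x hxH hx
  exact main r le_rfl

/-- **Descent, unconjugated slots.** The case `c = 1` of `exists_prod_commutator_mem_of_layers`:
`κ⁻¹ * ∏_j ⁅x j, g j⁆ ∈ A r` for suitable entries `x j ∈ H`. [cite: NikolovSegal2007, §4] -/
theorem exists_prod_commutator_mem_of_layers' {d : ℕ} (H : Subgroup G) [H.Normal] (g : Fin d → G)
    (A : ℕ → Subgroup G) (hAn : ∀ i, (A i).Normal) (r : ℕ)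
    (hstep : ∀ i < r, ∀ c' : Fin d → G, ∀ κ ∈ A i, ∃ y : Fin d → G, (∀ j, y j ∈ H) ∧
      κ⁻¹ * (List.ofFn fun j => ⁅y j, c' j * g j * (c' j)⁻¹⁆).prod ∈ A (i + 1))
    (κ : G) (hκ : κ ∈ A 0) :
    ∃ x : Fin d → G, (∀ j, x j ∈ H) ∧ κ⁻¹ * (List.ofFn fun j => ⁅x j, g j⁆).prod ∈ A r := by
  obtain ⟨x, hxH, hx⟩ := exists_prod_commutator_mem_of_layers H g A hAn r hstep (fun _ => 1) κ hκ
  exact ⟨x, hxH, by simpa using hx⟩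

end Literature.GroupTheory
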